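import Summits.Parity.GeneralizedHardyLittlewood.Theses.LiouvilleMAD
import Summits.Parity.GeneralizedHardyLittlewood.Theorems.LiouvilleMADTypeIIToLevelCollect
import Summits.Parity.GeneralizedHardyLittlewood.Theorems.LiouvilleMADTypeIIToLevelTypeI2
import Literature.NumberTheory.Sieve.DivisorBound

/-!
# `TypeIIToLevel` (route `LiouvilleMAD`): `TypeIILiouville → LambdaLiouvilleLevel`

Item stmt-Parity-14996 (`Summit.Parity.GeneralizedHardyLittlewood.Theses.LiouvilleMAD.TypeIIToLevel`),
support of route `LiouvilleMAD` (Parity / GeneralizedHardyLittlewood) = conjunct 3 of the crux `EngineToGHL`.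

**Theorem** (`TypeIIToLevel_proof`).  Power-saving type-II information for `λ(mn + h)` on the balanced
range (the node `TypeIILiouville`) implies Bombieri–Vinogradov at level `N^{ε₀}` for `Λ(n)λ(n + h)`
(the node `LambdaLiouvilleLevel`): for every `h ≠ 0` there is `ε₀ > 0` (here `ε₀ = min(η, 1/2)/100`) with
`∑_{q ≤ N^{ε₀}} |∑_{n ≤ y_q, n ≡ w_q (q)} Λ(n) λ(n + h)| ≤ C_A N (log N)^{−A}` for all residues `w_q` and
heights `y_q ≤ N`.

**Proof.**  For each `q` apply Vaughan's identity with `U = ⌊N^{1/10}⌋` to `Λ` against the class weight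
`lam_q(n) = 1[n ≡ w_q (q)] λ(n + h)` (`abs_sum_vonMangoldt_mul_le_param`, parts 1–2):
* type I (`d ≤ U²`): the sums `∑_{m ≤ t} lam_q(dm)` are `λ`-sums over one class modulo `lcm(d, q)`
  (part 4a), controlled ON AVERAGE over `(q, d)` — multiplicities `≤ τ(r)²`, Cauchy–Schwarz — by the
  PROVED tree theorem `BVLiouville` (Bombieri–Vinogradov for `λ`, `LiouvilleShiftedTables.BVLiouville` ←
  `Theorems/LiouvilleShiftedTablesBVLiouville`), total `≪ N (log N)^{−A}` (part 4b, `typeI_budget`);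
* type II (`U < d`, `U < m`): class splitting (cost `q`), dyadic boxes and `TypeIILiouville`, the cut
  `dm ≤ y` removed by short intervals in `d` (parts 1–3, `typeII_rect`), total
  `≪ N^{1 − min(η,1/2)/50 + o(1)}`;
* the piece `Λ_{≤U}` trivially.
Sources: Vaughan1980, IwaniecKowalski2004 §13.4, FriedlanderIwaniecAnnals1998 §26 (separation of variables),
BombieriFriedlanderIwaniecActa1986 (level-of-distribution bookkeeping).
-/

noncomputable section

open Finset Real ArithmeticFunction
open Literature.NumberTheory.LFunctions.LiouvilleSum (abs_liouville_le_one)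
open scoped ArithmeticFunction.sigma

namespace Summit.Parity.GeneralizedHardyLittlewood.Theorems.TypeIIToLevel

open Summit.Parity.GeneralizedHardyLittlewood.Theses.LiouvilleMAD (TypeIILiouville LambdaLiouvilleLevel
  TypeIIToLevel)

/-! ### The route item -/

/-- **`TypeIILiouville → LambdaLiouvilleLevel`** (item stmt-Parity-14996, conjunct 3 of `EngineToGHL`):
power-saving type-II information for `λ(mn + h)` on the balanced range gives Bombieri–Vinogradov at level
`N^{ε₀}`, `ε₀ = min(η, 1/2)/100`, for the sequence `Λ(n) λ(n + h)`, with a log-power saving (the saving is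
only log-power because the type-I input — the proved tree theorem Bombieri–Vinogradov for `λ` — is).
Vaughan's identity with `U = ⌊N^{1/10}⌋` inside each class (parts 1–2), type II by class splitting and
dyadic boxes (part 3), type I on average over `(q, d)` through `lcm(d, q)` with multiplicities `τ(r)²`
(part 4). [this line; Vaughan1980, IwaniecKowalski2004 §13.4, FriedlanderIwaniecAnnals1998 §26] -/
theorem TypeIIToLevel_proof : TypeIIToLevel := by
  intro hII h hh
  obtain ⟨η, hη, C₂, hC₂⟩ := hII h hh
  set η' : ℝ := min η (1 / 2) with hη'
  have hη'0 : 0 < η' := lt_min hη (by norm_num)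
  have hη'h : η' ≤ 1 / 2 := min_le_right _ _
  set C₂' : ℝ := max C₂ 0 with hC₂'
  have hC₂'0 : 0 ≤ C₂' := le_max_right _ _
  -- the bilinear bound with a nonnegative constant
  have hΦ : ∀ M N : ℕ, 1 ≤ N → N ≤ M → ∀ α β : ℕ → ℝ,
      |∑ m ∈ Ioc M (2 * M), ∑ n ∈ Ioc N (2 * N),
          α m * β n * (liouville (Int.toNat (((m * n : ℕ) : ℤ) + h)) : ℝ)| ≤
        C₂' * Real.sqrt (∑ m ∈ Ioc M (2 * M), α m ^ 2) * Real.sqrt (∑ n ∈ Ioc N (2 * N), β n ^ 2) *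
          (Real.sqrt ((M : ℝ) * N) * ((N : ℝ) ^ (-(1 / 2 : ℝ)) + (M : ℝ) ^ (-η))) := by
    intro M N hN hNM α β
    have h1 := hC₂ M N hN hNM α β
    simp only [Nat.cast_mul] at h1 ⊢
    refine h1.trans ?_
    have hX : 0 ≤ Real.sqrt (∑ m ∈ Ioc M (2 * M), α m ^ 2) * Real.sqrt (∑ n ∈ Ioc N (2 * N), β n ^ 2) *
        (Real.sqrt ((M : ℝ) * N) * ((N : ℝ) ^ (-(1 / 2 : ℝ)) + (M : ℝ) ^ (-η))) := by positivity
    calc C₂ * Real.sqrt (∑ m ∈ Ioc M (2 * M), α m ^ 2) * Real.sqrt (∑ n ∈ Ioc N (2 * N), β n ^ 2) *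
          Real.sqrt ((M : ℝ) * N) * ((N : ℝ) ^ (-(1 / 2 : ℝ)) + (M : ℝ) ^ (-η))
        = C₂ * (Real.sqrt (∑ m ∈ Ioc M (2 * M), α m ^ 2) * Real.sqrt (∑ n ∈ Ioc N (2 * N), β n ^ 2) *
          (Real.sqrt ((M : ℝ) * N) * ((N : ℝ) ^ (-(1 / 2 : ℝ)) + (M : ℝ) ^ (-η)))) := by ring
      _ ≤ C₂' * (Real.sqrt (∑ m ∈ Ioc M (2 * M), α m ^ 2) * Real.sqrt (∑ n ∈ Ioc N (2 * N), β n ^ 2) *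
          (Real.sqrt ((M : ℝ) * N) * ((N : ℝ) ^ (-(1 / 2 : ℝ)) + (M : ℝ) ^ (-η)))) :=
          mul_le_mul_of_nonneg_right (le_max_left _ _) hX
      _ = _ := by ring
  refine ⟨η' / 100, by positivity, fun A hA => ?_⟩
  -- constants
  obtain ⟨CI, X₀, hTI⟩ := typeI_budget h (A := A + 1) (by linarith)
  obtain ⟨Cτ, hCτ1, hCτ⟩ := Literature.NumberTheory.Sieve.exists_card_divisors_le_mul_rpow
    (ε := η' / 100) (by positivity)
  have hCτ0 : 0 ≤ Cτ := zero_le_one.trans hCτ1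
  set CI' : ℝ := max CI 0 with hCI'
  have hCI'0 : 0 ≤ CI' := le_max_right _ _
  set CII : ℝ := (96 * (10 * C₂' + 1) + 9) * Cτ with hCII
  have hCII0 : 0 ≤ CII := by positivity
  -- eventual inequalities
  have hev : ∀ᶠ x : ℝ in Filter.atTop, Real.log x ^ (A + 2) ≤ x ^ (η' / 50) ∧
      Real.log x ^ (A + 1) ≤ x ^ (4 / 5 : ℝ) ∧ (2 : ℝ) ^ (20 : ℕ) ≤ x :=
    (Literature.NumberTheory.Sieve.eventually_log_rpow_le_rpow (A + 2) (by positivity : 0 < η' / 50)).and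
      ((Literature.NumberTheory.Sieve.eventually_log_rpow_le_rpow (A + 1) (by norm_num : (0 : ℝ) < 4 / 5)).and
        (Filter.eventually_ge_atTop _))
  obtain ⟨x₁, hx₁⟩ := Filter.eventually_atTop.1 hev
  refine ⟨1 + 8 * CI' + CII, max (max X₀ h.natAbs) ⌈x₁⌉₊, fun N hN w y hyN => ?_⟩
  have hNX₀ : X₀ ≤ N := le_trans (le_max_left _ _) (le_of_max_le_left hN)
  have hNh : h.natAbs ≤ N := le_trans (le_max_right _ _) (le_of_max_le_left hN)
  have hNx₁ : x₁ ≤ N := (Nat.le_ceil x₁).trans (by exact_mod_cast le_of_max_le_right hN)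
  obtain ⟨hE1, hE2, hN20⟩ := hx₁ N hNx₁
  -- basic quantities
  have hN1 : (1 : ℝ) ≤ N := le_trans (by norm_num) hN20
  have hN0 : (0 : ℝ) < N := by linarith
  have hNnat : 1 ≤ N := by exact_mod_cast hN1
  set L : ℝ := Real.log N with hL
  have hL1 : 1 ≤ L := by
    rw [hL, ← Real.log_exp 1]
    refine Real.log_le_log (Real.exp_pos 1) (le_trans ?_ hN20)
    have := Real.exp_one_lt_d9; norm_num at this ⊢; linarith
  have hL0 : 0 < L := by linarith
  -- powers of `N`
  have ePow : ∀ a b : ℝ, (N : ℝ) ^ a * (N : ℝ) ^ b = (N : ℝ) ^ (a + b) := fun a b => (Real.rpow_add hN0 a b).symm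
  have mPow : ∀ a b : ℝ, a ≤ b → (N : ℝ) ^ a ≤ (N : ℝ) ^ b := fun a b hab =>
    Real.rpow_le_rpow_of_exponent_le hN1 hab
  have onePow : ∀ a : ℝ, 0 ≤ a → (1 : ℝ) ≤ (N : ℝ) ^ a := fun a ha => Real.one_le_rpow hN1 ha
  set P : ℝ := (N : ℝ) ^ (η' / 100) with hP
  set u : ℝ := (N : ℝ) ^ (1 / 10 : ℝ) with hu
  set κ : ℝ := (N : ℝ) ^ (η' / 20) with hκ
  have hP1 : 1 ≤ P := onePow _ (by positivity)
  have hκ1 : 1 ≤ κ := onePow _ (by positivity)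
  have hκu : κ ≤ u := mPow _ _ (by linarith)
  have hu4 : 4 ≤ u := by
    have h220 : (4 : ℝ) = ((2 : ℝ) ^ (20 : ℕ)) ^ (1 / 10 : ℝ) := by
      rw [← Real.rpow_natCast, ← Real.rpow_mul (by norm_num)]; norm_num
    rw [h220, hu]; exact Real.rpow_le_rpow (by positivity) hN20 (by norm_num)
  have hu0 : 0 < u := by linarith
  have hκ0 : 0 < κ := by linarith
  -- the parameters
  set Q : ℕ := ⌊(N : ℝ) ^ (η' / 100)⌋₊ with hQ
  have hQP : (Q : ℝ) ≤ P := Nat.floor_le (by positivity)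
  set U : ℕ := ⌊u⌋₊ with hU
  have hUu : (U : ℝ) ≤ u := Nat.floor_le hu0.le
  have huU : u ≤ U + 1 := (Nat.lt_floor_add_one u).le
  have hU4 : 4 ≤ U := by
    rw [hU]; exact Nat.le_floor (by exact_mod_cast hu4)
  have hU2 : 2 ≤ U := by omega
  have hUr0 : (0 : ℝ) < U := by exact_mod_cast (by omega : 0 < U)
  have hUhalf : u / 2 ≤ U := by linarith
  have hV : u / 8 ≤ ((U / 2 : ℕ) : ℝ) := by
    have h1 : ((U : ℝ) - 1) / 2 ≤ ((U / 2 : ℕ) : ℝ) := by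
      have := Nat.div_add_mod U 2
      have h2 : (U : ℝ) = 2 * ((U / 2 : ℕ) : ℝ) + ((U % 2 : ℕ) : ℝ) := by exact_mod_cast this.symm
      have h3 : ((U % 2 : ℕ) : ℝ) ≤ 1 := by
        have := Nat.mod_lt U two_pos
        exact_mod_cast (by omega : U % 2 ≤ 1)
      linarith
    have h4 : (4 : ℝ) ≤ U := by exact_mod_cast hU4
    linarith
  have hUN : U ≤ N := by
    have : (U : ℝ) ≤ N := hUu.trans (by rw [hu]; simpa using mPow (1 / 10) 1 (by norm_num))
    exact_mod_cast this
  set K : ℕ := ⌈κ⌉₊ with hK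
  have hKκ : κ ≤ K := Nat.le_ceil κ
  have hK1 : 1 ≤ K := by
    have : (0 : ℝ) < K := hκ0.trans_le hKκ
    exact_mod_cast this
  have hK2 : (K : ℝ) ≤ 2 * κ := by
    have := (Nat.ceil_lt_add_one hκ0.le).le; rw [← hK] at this; linarith
  have hKr0 : (0 : ℝ) < K := by exact_mod_cast hK1
  set J : ℕ := Nat.log 2 N + 1 with hJ
  have h2J : N < 2 ^ J := Nat.lt_pow_succ_log_self one_lt_two N
  have hNJ : N ≤ U * 2 ^ J := h2J.le.trans (Nat.le_mul_of_pos_left _ (by omega))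
  have hJle : (J : ℝ) ≤ 3 * L := by
    have h2J' : ((2 ^ Nat.log 2 N : ℕ) : ℝ) ≤ N := by exact_mod_cast Nat.pow_log_le_self 2 (by omega)
    have hlog2 : Real.log 2 * (Nat.log 2 N) ≤ L := by
      have := Real.log_le_log (by positivity) h2J'
      rw [Nat.cast_pow, Nat.cast_ofNat, Real.log_pow] at this
      rw [hL]; linarith
    have hl2 : (1 / 2 : ℝ) < Real.log 2 := by
      have := Real.log_two_gt_d9; linarith
    have hk0 : (0 : ℝ) ≤ Nat.log 2 N := Nat.cast_nonneg _
    have hk : (Nat.log 2 N : ℝ) * (1 / 2) ≤ (Nat.log 2 N : ℝ) * Real.log 2 :=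
      mul_le_mul_of_nonneg_left hl2.le hk0
    rw [hJ]; push_cast
    linarith [mul_comm (Nat.log 2 N : ℝ) (Real.log 2)]
  set T : ℝ := Cτ * P with hT
  have hT1 : 1 ≤ T := by rw [hT]; exact one_le_mul_of_one_le_of_one_le hCτ1 hP1
  have hT0 : 0 ≤ T := by linarith
  have hτ : ∀ n, n ≤ N → ((Nat.divisors n).card : ℝ) ≤ T := by
    intro n hn
    rcases Nat.eq_zero_or_pos n with rfl | hn0
    · simp; positivity
    · refine (hCτ n hn0.ne').trans ?_
      exact mul_le_mul_of_nonneg_left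
        (Real.rpow_le_rpow (Nat.cast_nonneg n) (by exact_mod_cast hn) (by positivity)) hCτ0
  -- the type-I budget at the height `X = N + |h|`
  set X : ℕ := N + h.natAbs with hXdef
  have hX : (N : ℤ) + h ≤ X := by
    rw [hXdef]; push_cast; linarith [le_abs_self h]
  have hX₀X : X₀ ≤ X := hNX₀.trans (Nat.le_add_right _ _)
  have hXN : (X : ℝ) ≤ 2 * N := by
    rw [hXdef]; push_cast
    have : ((h.natAbs : ℕ) : ℝ) ≤ N := by exact_mod_cast hNh
    linarith
  have hNX : (N : ℝ) ≤ X := by rw [hXdef]; push_cast; linarith [(Nat.cast_nonneg h.natAbs : (0 : ℝ) ≤ _)]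
  have hQD : ((Q * (U * U) : ℕ) : ℝ) ≤ (X : ℝ) ^ (1 / 2 - 1 / 20 : ℝ) := by
    have h1 : ((Q * (U * U) : ℕ) : ℝ) ≤ P * (u * u) := by
      push_cast; exact mul_le_mul hQP (mul_le_mul hUu hUu hUr0.le hu0.le) (by positivity) (by positivity)
    have h2 : P * (u * u) = (N : ℝ) ^ (η' / 100 + 1 / 5) := by
      rw [hP, hu, ePow, ePow]; norm_num
    have h3 : (N : ℝ) ^ (η' / 100 + 1 / 5) ≤ (N : ℝ) ^ (1 / 2 - 1 / 20 : ℝ) := mPow _ _ (by linarith)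
    have h4 : (N : ℝ) ^ (1 / 2 - 1 / 20 : ℝ) ≤ (X : ℝ) ^ (1 / 2 - 1 / 20 : ℝ) :=
      Real.rpow_le_rpow hN0.le hNX (by norm_num)
    linarith
  obtain ⟨F, hF0, hF, hFsum⟩ := hTI X hX₀X Q (U * U) hQD
  -- the bound for one modulus, uniform in `q ≤ Q`
  set E : ℝ := U * Real.log U + J * (K * (L * T * ((10 * C₂' + 1) * Q *
    ((((U / 2 : ℕ) : ℝ)) ^ (-η') + (U : ℝ) ^ (-η'))) * N) + L * T * ((N : ℝ) / K + (N : ℝ) / U)) with hE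
  have hperq : ∀ q ∈ Icc 1 Q,
      |∑ n ∈ (Icc 1 (y q)).filter (fun n : ℕ => n ≡ w q [MOD q]),
          ArithmeticFunction.vonMangoldt n * (liouville (Int.toNat ((n : ℤ) + h)) : ℝ)| ≤
        E + 4 * L * ∑ d ∈ Icc 1 (U * U), F q d := by
    intro q hq
    obtain ⟨hq1, hqQ⟩ := mem_Icc.1 hq
    have hb := abs_corr_class_le (h := h) hη hC₂'0 hΦ hU2 hUN hNJ hK1 hT1 hτ hX F hF0 hF hq1 (w q) (hyN q)
    refine hb.trans ?_
    have hqQ' : (q : ℝ) ≤ Q := by exact_mod_cast hqQ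
    have hVY : 0 ≤ (((U / 2 : ℕ) : ℝ)) ^ (-η') + (U : ℝ) ^ (-η') := by positivity
    have hWmono : (10 * C₂' + 1) * q * ((((U / 2 : ℕ) : ℝ)) ^ (-η') + (U : ℝ) ^ (-η')) ≤
        (10 * C₂' + 1) * Q * ((((U / 2 : ℕ) : ℝ)) ^ (-η') + (U : ℝ) ^ (-η')) :=
      mul_le_mul_of_nonneg_right (mul_le_mul_of_nonneg_left hqQ' (by positivity)) hVY
    have hrest : (J : ℝ) * (K * (Real.log N * T * ((10 * C₂' + 1) * q *
        ((((U / 2 : ℕ) : ℝ)) ^ (-η') + (U : ℝ) ^ (-η'))) * N) + Real.log N * T * ((N : ℝ) / K + (N : ℝ) / U)) ≤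
        J * (K * (L * T * ((10 * C₂' + 1) * Q * ((((U / 2 : ℕ) : ℝ)) ^ (-η') + (U : ℝ) ^ (-η'))) * N) +
          L * T * ((N : ℝ) / K + (N : ℝ) / U)) := by
      rw [← hL]
      refine mul_le_mul_of_nonneg_left (add_le_add ?_ le_rfl) (Nat.cast_nonneg J)
      refine mul_le_mul_of_nonneg_left ?_ hKr0.le
      exact mul_le_mul_of_nonneg_right (mul_le_mul_of_nonneg_left hWmono (by positivity)) hN0.le
    rw [hE]
    linarith
  -- sum over the moduli
  have hsum : ∑ q ∈ Icc 1 Q, |∑ n ∈ (Icc 1 (y q)).filter (fun n : ℕ => n ≡ w q [MOD q]),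
      ArithmeticFunction.vonMangoldt n * (liouville (Int.toNat ((n : ℤ) + h)) : ℝ)| ≤
      Q * E + 4 * L * ∑ q ∈ Icc 1 Q, ∑ d ∈ Icc 1 (U * U), F q d := by
    refine (sum_le_sum hperq).trans (le_of_eq ?_)
    rw [sum_add_distrib, sum_const, Nat.card_Icc, Nat.add_sub_cancel, nsmul_eq_mul, mul_sum]
  refine hsum.trans ?_
  -- the type-I part
  have hlogX : L ≤ Real.log X := Real.log_le_log hN0 hNX
  have hlogXpos : 0 < Real.log X ^ (A + 1) := Real.rpow_pos_of_pos (hL0.trans_le hlogX) _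
  have hTIle : 4 * L * ∑ q ∈ Icc 1 Q, ∑ d ∈ Icc 1 (U * U), F q d ≤ 8 * CI' * N / L ^ A := by
    have h1 : ∑ q ∈ Icc 1 Q, ∑ d ∈ Icc 1 (U * U), F q d ≤ CI' * X / Real.log X ^ (A + 1) := by
      refine hFsum.trans ?_
      gcongr
      exact le_max_left _ _
    have h2 : CI' * X / Real.log X ^ (A + 1) ≤ CI' * (2 * N) / L ^ (A + 1) := by
      have hLA : 0 < L ^ (A + 1) := Real.rpow_pos_of_pos hL0 _
      refine div_le_div₀ (by positivity) (mul_le_mul_of_nonneg_left hXN hCI'0) hLA ?_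
      exact Real.rpow_le_rpow hL0.le hlogX (by linarith)
    have hLA1 : L ^ (A + 1) = L ^ A * L := by rw [Real.rpow_add hL0, Real.rpow_one]
    have hS0 : 0 ≤ ∑ q ∈ Icc 1 Q, ∑ d ∈ Icc 1 (U * U), F q d :=
      sum_nonneg fun q _ => sum_nonneg fun d _ => hF0 q d
    calc 4 * L * ∑ q ∈ Icc 1 Q, ∑ d ∈ Icc 1 (U * U), F q d ≤ 4 * L * (CI' * (2 * N) / L ^ (A + 1)) :=
          mul_le_mul_of_nonneg_left (h1.trans h2) (by positivity)
      _ = 8 * CI' * N / L ^ A := by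
          rw [hLA1]
          have : L ^ A ≠ 0 := (Real.rpow_pos_of_pos hL0 A).ne'
          field_simp
          ring
  -- the trivial and type-II parts: `Q · E ≤ (1 + CII) N / L^A` (pure real bookkeeping)
  have hQE : (Q : ℝ) * E ≤ (1 + CII) * N / L ^ A := by
    have hc := collect_le (A := A) hη'0 hη'h hL0 hN1 hP hu hκ (Nat.cast_nonneg Q) hQP hUr0 hUu hUhalf
      (by exact_mod_cast hUN) hu4 hV hKκ hK2 (Nat.cast_nonneg J) hJle hT hCτ0 hC₂'0 hL hE1 hE2
    rw [hE, hCII]; exact hc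
  calc (Q : ℝ) * E + 4 * L * ∑ q ∈ Icc 1 Q, ∑ d ∈ Icc 1 (U * U), F q d
      ≤ (1 + CII) * N / L ^ A + 8 * CI' * N / L ^ A := add_le_add hQE hTIle
    _ = (1 + 8 * CI' + CII) * N / L ^ A := by ring

end Summit.Parity.GeneralizedHardyLittlewood.Theorems.TypeIIToLevel

end
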